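import Mathlib
import Summits.ValiantsHypothesis.ValiantsHypothesis.Theses.FeketeSOS
import Literature.Analysis.Fourier.FiniteUncertaintyPrinciple

/-!
# Sketch — crux-ideate FeketeBoundedFanin (stmt-ValiantsHypothesis-3998), ideator 2, round 1

First-lemma signatures for the two idea cards `witt-pascal-ufa` and `dilation-chebotarev`.
Nothing here is proved; every `def … : Prop` is a STATEMENT. Which ones are claimed provable-now
and which are conjectural is said in the docstrings and in the cards.
-/

open Polynomial Finset
open scoped BigOperators

namespace Summit.ValiantsHypothesis.ValiantsHypothesis.Cruxes.FeketeBoundedFanin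

/-- The Fekete polynomial over a commutative ring (coefficients `(m|p)` cast). -/
noncomputable def fekete (R : Type*) [CommRing R] (p : ℕ) [Fact p.Prime] : Polynomial R :=
  ∑ m ∈ Finset.range p, C (((legendreSym p m : ℤ)) : R) * X ^ m

/-! ## Card `witt-pascal-ufa` -/
namespace WittPascal

/-- (provable now, linear algebra) Witt pairing over an algebraically closed field: two weighted
squares are one product of two polynomials supported inside the union of the two supports. Iterating,
`2k` weighted squares are `k` sparse products (and `2k+1` are `k` products plus one square). -/
def WittPair : Prop :=
  ∀ (K : Type) [Field K] [IsAlgClosed K] (c₀ c₁ : K) (h₀ h₁ : K[X]),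
    ∃ L L' : K[X], C c₀ * h₀ ^ 2 + C c₁ * h₁ ^ 2 = L * L' ∧
      L.support ⊆ h₀.support ∪ h₁.support ∧ L'.support ⊆ h₀.support ∪ h₁.support

/-- (provable now, "maximal-minor trick") Gauss-orthonormal bases: a `d`-dimensional subspace of
`Fin n → L` over a field `L` with a valuation subring `A` has a basis with `A`-integral coordinates
containing a `d × d` identity submatrix; such a basis is orthonormal for the Gauss (sup) norm and its
coordinatewise reductions modulo the maximal ideal of `A` stay linearly independent. -/
def GaussOrthonormal : Prop :=
  ∀ (L : Type) [Field L] (A : ValuationSubring L) (n d : ℕ) (w : Fin d → (Fin n → L)),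
    LinearIndependent L w →
    ∃ (P : Matrix (Fin d) (Fin d) L) (J : Fin d → Fin n), IsUnit P.det ∧ Function.Injective J ∧
      (∀ j i, (∑ l, P j l * w l i) ∈ A) ∧
      (∀ j j', (∑ l, P j l * w l (J j')) = if j = j' then 1 else 0)

/-- (provable now, size M/L) Faithful reduction at a place of `ℂ` above `p` in a Gauss-orthonormal
basis of `W = span(g_i)`: a complex representation of `F_p` by `s` weighted squares yields, over an
algebraically closed field `K` of characteristic `p`, `d ≤ s` LINEARLY INDEPENDENT polynomials `w_j`
supported inside `⋃ supp g_i` and a non-zero symmetric `d × d` matrix `T` with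
`Σ T_{jj'} w_j w_{j'} = u · F̄_p`; `u ≠ 0` is the non-cancelling branch, `u = 0` the cancelling one
(a sparse quadratic syzygy among independent fewnomials). Support bookkeeping:
`Σ_j |supp w_j| ≤ s · Σ_i |supp g_i|`. -/
def PlaceDichotomy : Prop :=
  ∀ (p : ℕ) [Fact p.Prime] (s : ℕ) (c : Fin s → ℂ) (g : Fin s → ℂ[X]),
    (∑ i, C (c i) * g i ^ 2) = fekete ℂ p →
    ∃ (K : Type) (_ : Field K) (_ : CharP K p) (_ : IsAlgClosed K) (d : ℕ) (_ : d ≤ s)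
      (w : Fin d → K[X]) (T : Matrix (Fin d) (Fin d) K) (u : K),
      LinearIndependent K w ∧ T ≠ 0 ∧ T.IsSymm ∧
      (∀ j, (w j).support ⊆ Finset.univ.biUnion fun i => (g i).support) ∧
      (∑ j, ∑ j', C (T j j') * (w j * w j')) = C u * fekete K p

/-- (provable now, the binomial case of UFA, characteristic 0) UNIPOTENT FEWNOMIAL ABC for binomials
`x^a − 1`: if `A = ∏_{j<m} (x^{a_j} − 1)` and `B = ∏_{j<m} (x^{b_j} − 1)` then for every constant `c`
either `A = c·B` or `ord_{x=1}(A − c·B) ≤ 3m + 1`. Proof: `ord` of each product is `m`; after the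
leading constants cancel, `log(A/B)` at `x = 1 + y` is `Σ_j L(a_j;y) − Σ_j L(b_j;y)` with
`L(a;y) = log(((1+y)^a − 1)/(a y))`, whose `y^n`-coefficient lies in `span{a, a^2, a^4, …}` (evenness
of `log((e^u−1)/u) − u/2`, Bernoulli numbers `B_{2i} ≠ 0`), so agreement to order `2m+1` forces equal
power sums of `{a_j^2}` up to `m`, hence equal multisets (Newton), hence `A = B`. Prouhet–Tarry–Escott
multisets show the linear order of magnitude is sharp. -/
def UFABinomialCharZero : Prop :=
  ∀ (K : Type) [Field K] [CharZero K] (m : ℕ) (a b : Fin m → ℕ) (c : K),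
    (∀ j, 0 < a j) → (∀ j, 0 < b j) →
    ((∏ j, ((X : K[X]) ^ (a j) - 1)) - C c * ∏ j, ((X : K[X]) ^ (b j) - 1)) = 0 ∨
    ((∏ j, ((X : K[X]) ^ (a j) - 1)) - C c * ∏ j, ((X : K[X]) ^ (b j) - 1)).rootMultiplicity 1
      ≤ 3 * m + 1

/-- (CONJECTURAL — the load-bearing new lemma) UNIPOTENT FEWNOMIAL ABC in characteristic `p`: for
fewnomials `P_j, Q_j` (`j < k`) with exponents `< p`, the products `∏ P_j` and `c · ∏ Q_j` cannot agree
at the unipotent point `x = 1` to order more than `C₀(k) · (total number of monomials)`, unless they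
agree to order `≥ p` (Frobenius: `(x−1)^p = x^p − 1`). Dimension count: a `t`-nomial has `2t − 2`
shape parameters at `x = 1`, so order `≈ 2 Σ t` is reachable and no more is expected; the binomial
case is `UFABinomialCharZero` (char 0) and holds in char `p` away from irregular pairs. -/
def UnipotentFewnomialABC (C₀ : ℕ → ℕ) : Prop :=
  ∀ (K : Type) [Field K] (p : ℕ) [Fact p.Prime] [CharP K p] (k : ℕ) (P Q : Fin k → K[X]) (c : K),
    (∀ j, P j ≠ 0 ∧ (P j).natDegree < p) → (∀ j, Q j ≠ 0 ∧ (Q j).natDegree < p) →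
    (X - C 1) ^ p ∣ ((∏ j, P j) - C c * ∏ j, Q j) ∨
    ((∏ j, P j) - C c * ∏ j, Q j).rootMultiplicity 1
      ≤ C₀ k * ∑ j, ((P j).support.card + (Q j).support.card)

/-- (target of the non-cancelling branch for `s₀ ≤ 4`, char-`p` shadow after Witt pairing)
`L₁L₂ + L₃L₄ = u·F̄_p` with `u ≠ 0` forces a LINEAR total support. Claimed implication (card, §line):
`CharPFewnomial ∧ FeketeModPOrder ∧ UnipotentFewnomialABC C₀ → CharPTwoProducts (2·C₀ 2 + 2)`
(`CharPFewnomial`, `FeketeModPOrder` are the sibling line's stubs on crux FeketeNoSparseSplit). -/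
def CharPTwoProducts (C₁ : ℕ) : Prop :=
  ∀ (K : Type) [Field K] (p : ℕ) [Fact p.Prime] [CharP K p], p ≠ 2 →
    ∀ (L₁ L₂ L₃ L₄ : K[X]) (u : K), u ≠ 0 →
      (∀ L ∈ [L₁, L₂, L₃, L₄], (X ^ p - 1 : K[X]) ∣ L → L = 0) →
      L₁ * L₂ + L₃ * L₄ = C u * fekete K p →
      p ≤ C₁ * (L₁.support.card + L₂.support.card + L₃.support.card + L₄.support.card)

/-- The composition claimed for the non-cancelling branch, `s₀ ≤ 4` (to be proved by a crux-plan;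
stated here only so that the shape elaborates). -/
def NonCancellingComposition : Prop :=
  ∀ C₀ : ℕ → ℕ, UnipotentFewnomialABC C₀ → CharPTwoProducts (2 * C₀ 2 + 2)

/-- (CONJECTURAL hypothesis — "no forced cancellation at `p`"; the card's cancelling-branch digit
descent is the proposed way to REMOVE it) some representation with the same support sets reduces, at
some place above `p` and in a Gauss-orthonormal basis, with a `p`-INTEGRAL Gram matrix, i.e.
`PlaceDichotomy` can be realised with `u ≠ 0`. (At the prime `2` cancellation IS forced — the identity
is impossible in characteristic `2` — so this is a statement about `ℓ = p` specifically.) -/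
def NoForcedCancellation : Prop :=
  ∀ (p : ℕ) [Fact p.Prime] (s : ℕ) (c : Fin s → ℂ) (g : Fin s → ℂ[X]),
    (∑ i, C (c i) * g i ^ 2) = fekete ℂ p →
    ∃ (K : Type) (_ : Field K) (_ : CharP K p) (_ : IsAlgClosed K) (d : ℕ) (_ : d ≤ s)
      (w : Fin d → K[X]) (T : Matrix (Fin d) (Fin d) K) (u : K),
      LinearIndependent K w ∧ u ≠ 0 ∧ T.IsSymm ∧
      (∀ j, (w j).support ⊆ Finset.univ.biUnion fun i => (g i).support) ∧
      (∑ j, ∑ j', C (T j j') * (w j * w j')) = C u * fekete K p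

/-- (CONJECTURAL for `s ≥ 3`; `s ≤ 2` is the sibling line; `s ≤ 4` follows from UFA by
`NonCancellingComposition`) the NON-CANCELLING char-`p` shadow at fan-in `s`: a linear total support.
(`u = 0` must be excluded: `x^{2a} · x^{2b} − (x^{a+b})² = 0` is a 3-term syzygy.) -/
def CharPNonCancelling (s C₁ : ℕ) : Prop :=
  ∀ (K : Type) [Field K] (p : ℕ) [Fact p.Prime] [CharP K p] [IsAlgClosed K], p ≠ 2 →
    ∀ (d : ℕ), d ≤ s → ∀ (w : Fin d → K[X]) (T : Matrix (Fin d) (Fin d) K) (u : K),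
      LinearIndependent K w → u ≠ 0 → T.IsSymm →
      (∑ j, ∑ j', C (T j j') * (w j * w j')) = C u * fekete K p →
      p ≤ C₁ * ∑ j, (w j).support.card

/-- Transfer shape (provable logic + real arithmetic: `Σ_j |supp w_j| ≤ s · Σ_i |supp g_i|`, then
`p ≤ C₁ s · Σ_i |supp g_i|` beats `p^{3/4}` for `p` large). -/
def Transfer : Prop :=
  NoForcedCancellation → (∀ s, ∃ C₁, 0 < C₁ ∧ CharPNonCancelling s C₁) →
    Summit.ValiantsHypothesis.ValiantsHypothesis.Theses.FeketeSOS.FeketeBoundedFanin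

end WittPascal

/-! ## Card `dilation-chebotarev` -/
namespace DilationChebotarev

open Literature.Analysis.Fourier

/-- cyclic convolution on `ℤ/p`. -/
noncomputable def cconv {p : ℕ} [NeZero p] (f g : ZMod p → ℂ) : ZMod p → ℂ :=
  fun n => ∑ a, f a * g (n - a)

/-- `χ̃`: the Legendre symbol as a function on `ℤ/p` (value `0` at `0`). -/
noncomputable def chiTilde (p : ℕ) [Fact p.Prime] : ZMod p → ℂ :=
  fun n => ((legendreSym p (n.val : ℤ) : ℤ) : ℂ)

/-- dilation `(D_k f)(x) = f(kx)`. -/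
def dilate {p : ℕ} (k : ZMod p) (f : ZMod p → ℂ) : ZMod p → ℂ := fun x => f (k * x)

/-- (provable now from `tao2005_uncertainty_prime_holds`) RIGIDITY OF SPARSE CONVOLUTION SQUARE
ROOTS in a cyclic group of prime order: `f ⊛ f = g ⊛ g` forces `f = ±g` unless the supports are
large. Proof: `(𝓕f − 𝓕g)(𝓕f + 𝓕g) = 0` pointwise, so the zero sets of `𝓕(f−g)` and `𝓕(f+g)` cover
`ℤ/p`; Tao's `|supp h| + |supp 𝓕h| ≥ p+1` gives `|supp(f−g)| + |supp(f+g)| ≥ p + 2`. -/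
def SqrtRigidity : Prop :=
  ∀ (p : ℕ) [Fact p.Prime] (f g : ZMod p → ℂ), cconv f f = cconv g g →
    f = g ∨ f = -g ∨ p + 2 ≤ 2 * ((zmodSupport f).card + (zmodSupport g).card)

/-- (provable now) dilation twist: `χ̃` is an eigenfunction of every dilation, so a cyclic
representation by `s` weighted convolution squares yields `p − 1` of them, with dilated supports. -/
def DilationTwist : Prop :=
  ∀ (p : ℕ) [Fact p.Prime] (s : ℕ) (c : Fin s → ℂ) (h : Fin s → ZMod p → ℂ) (k : ZMod p), k ≠ 0 →
    (∑ i, c i • cconv (h i) (h i)) = chiTilde p →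
    (∑ i, (c i * chiTilde p k) • cconv (dilate k (h i)) (dilate k (h i))) = chiTilde p

/-- (provable now: `SqrtRigidity` + `DilationTwist` + orbit argument) THE CYCLIC ONE-SQUARE THEOREM:
every cyclic convolution square root of `c·χ̃` has support `≥ (p+2)/4` — the refuter's dense
quartic-character square root (`p ≡ 1 mod 4`) is, up to a factor 4, as sparse as possible. -/
def CyclicOneSquare : Prop :=
  ∀ (p : ℕ) [Fact p.Prime] (h : ZMod p → ℂ) (c : ℂ), c ≠ 0 →
    cconv h h = (fun n => c * chiTilde p n) → p + 2 ≤ 4 * (zmodSupport h).card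

/-- A symmetric matrix on `ℤ/p × ℤ/p` is a LIFTED (polynomial) SYZYGY if for some choice of integer
representatives of the indices all INTEGER antidiagonal sums vanish (the relation already holds in
`ℂ[x, x⁻¹]`, not only in `ℂ[x]/(x^p − 1)`). Example: `(A²)(B²) = (AB)²` for fewnomials `A, B`. -/
def IsLiftedSyzygy {p : ℕ} [NeZero p] (M : Matrix (ZMod p) (ZMod p) ℂ) : Prop :=
  ∃ ℓ : ZMod p → ℤ, (∀ a, ((ℓ a : ℤ) : ZMod p) = a) ∧
    ∀ n : ℤ, (∑ a, ∑ b, if ℓ a + ℓ b = n then M a b else 0) = 0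

/-- (rank 2 provable now = `SqrtRigidity` + the hyperbolic case `u ⊛ v = 0`; rank ≥ 3 CONJECTURAL)
KERNEL RANK RIGIDITY: a non-zero symmetric matrix of rank `≤ r` with vanishing CYCLIC antidiagonal
sums and rows/columns supported in `U` is a lifted syzygy or has `|U| ≥ c₀ p`. Dimension count: for
`|U| = t` the kernel of the cyclic antidiagonal projection on `Sym(U)` has dimension `≈ t²/2 − p`, so
its generic minimal rank is `≈ p/t`, far above `r = O(1)` when `t ≪ p`. -/
def KernelRankRigidity (r : ℕ) (c₀ : ℝ) : Prop :=
  ∀ (p : ℕ) [Fact p.Prime] (M : Matrix (ZMod p) (ZMod p) ℂ) (U : Finset (ZMod p)),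
    M ≠ 0 → M.IsSymm → M.rank ≤ r → (∀ a b, M a b ≠ 0 → a ∈ U ∧ b ∈ U) →
    (∀ n : ZMod p, (∑ a, M a (n - a)) = 0) →
    IsLiftedSyzygy M ∨ c₀ * p ≤ U.card

/-- `C⁺` (cyclic bounded fan-in, linear): the strengthening this card aims at. -/
def CyclicBoundedFanin (s : ℕ) (c₀ : ℝ) : Prop :=
  ∀ (p : ℕ) [Fact p.Prime] (c : Fin s → ℂ) (h : Fin s → ZMod p → ℂ),
    (∑ i, c i • cconv (h i) (h i)) = chiTilde p → c₀ * p ≤ ∑ i, ((zmodSupport (h i)).card : ℝ)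

/-- Transfer shape: `C⁺` for every `s` implies the crux (fold `g_i` modulo `x^p − 1`; supports only
shrink; `p^{1/2+δ} ≤ c₀ p` for `δ < 1/2` and `p` large). -/
def Transfer : Prop :=
  (∀ s, ∃ c₀ : ℝ, 0 < c₀ ∧ CyclicBoundedFanin s c₀) →
    Summit.ValiantsHypothesis.ValiantsHypothesis.Theses.FeketeSOS.FeketeBoundedFanin

end DilationChebotarev

end Summit.ValiantsHypothesis.ValiantsHypothesis.Cruxes.FeketeBoundedFanin
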